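import Literature.MathematicalPhysics.QuantumFieldTheory.Balaban1983to89.InfiniteVolumeSufficientXXI
import HarnessLib

/-!
# Lévy's density theorem on a FINITE graph: the Wilson loops based at one vertex span a dense subalgebra of the
# gauge-invariant continuous functions (natural-representation form; instance `SU(2)`)

T. Lévy, *Wilson loops in the light of spin networks*, J. Geom. Phys. 52 (2004) 382–397 = arXiv:math-ph/0306059, Thm 3.1
(p.5): «Let `G` be a finite product of groups among `U(n), SU(n), O(n), SO(n), Sp(n)`. Let `Γ = (E, V)` be a graph. Then the
algebra generated by the Wilson loops is dense in the space of continuous functions on `C^G_Γ = G^E/G^V`.»  Its proof splits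
(Props 3.4–3.6, p.5) into (i) a purely COMBINATORIAL part — a gauge-invariant function of a configuration on a connected
graph is a function, invariant under simultaneous conjugation, of the holonomies of the loops based at one vertex («for every
vertex `w`, choose a path `p` in `Γ` joining `w` to `v`», proof of Prop 3.5), and words in those holonomies are again
holonomies of based loops (proof of Prop 3.6) — and (ii) an INVARIANT-THEORETIC part (Prop 3.4: diagonal conjugacy classes
of `G^r` are separated by the conjugacy classes of all words; A. Sengupta, Proc. AMS 121 (1994) 897–905, Thm 2 p.900, with
the traces of the words in the defining representation of `U(n)`, `SU(n)`, `O(n)`, `SO(2n+1)`), concluded by «Since this space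
is compact, the result follows by the Stone-Weierstrass theorem» (proof of Prop 3.6).

The tree already holds part (ii) as the several-variable schema `Balaban1983to89.Missing.TraceWordsDense ρ` (module
`InfiniteVolumeSufficientXX`: polynomials in `Re/Im tr ρ(w(V₁,…,V_r))` are uniformly dense in the continuous
diagonally-conjugation-invariant functions on `G^r`), PROVED for `SU(2)` with its defining representation
(`traceWordsDense_su2`, module `InfiniteVolumeSufficientXXI`, from the orbit-separation theorem
`traceWordsSeparateOrbits_su2`), and part (i) on the infinite lattice `ℤ^d` for cylinder functions (module XX, PART A/B:
the LASSO REPRESENTATION).  THIS FILE proves part (i) — and hence the theorem, given the schema — for an ARBITRARY FINITE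
CONNECTED ORIENTED MULTIGRAPH `(src tgt : E → V)`, the setting of Lévy's statement and of every finite periodic lattice
(the unit lattices of the `d = 3` torus schemes of `T3ContinuumYM3Torus`, whose threshold-removal step asks for exactly this
density; cell ym3-torus, TARGET N9 «D2»):

* `LevyDensity.IsPath src tgt x l y` — signed-edge lists as paths; `invPath`, `isPath_append`, `isPath_invPath`; the holonomy
  of a list is module XX's `wordVal l U = ∏ U_e^{±1}`; under a gauge transformation `u : V → G`,
  `(u • U) e = u(src e) · U e · u(tgt e)⁻¹` (`gaugeAct`), the holonomy of a GENUINE path `x ⤳ y` transforms as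
  `u x · hol · (u y)⁻¹` (`wordVal_gaugeAct`), so traces of holonomies of based loops are gauge invariant
  (`isGaugeInvariant_loopTraceProduct`);
* the LASSO REPRESENTATION (`lassoWord`, `lassoConfig`, `axialGauge`, `gaugeAct_axialGauge`, `eq_lassoConfig`): for any choice
  `π x` of paths from the base vertex `v₀` to the vertices `x`, gauge-transforming `U` by its own axial gauge function
  `x ↦ hol_U(π x)` yields the configuration of lasso holonomies `e ↦ hol_U(π(src e) · e · π(tgt e)⁻¹)`, whence
  `F U = F (lassoConfig U)` for every gauge-invariant `F` (Lévy's proof of Prop 3.5); words in lassos are based loops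
  (`wordLassoWord`, `wordVal_wordLassoWord`, `isPath_wordLassoWord`; proof of Prop 3.6);
* THE THEOREM `LevyDensity.dense_of_traceWordsDense`: for a compact-or-not topological group `G`, a matrix representation `ρ`
  with `TraceWordsDense ρ`, a finite edge type `E`, a base vertex `v₀` joined to every vertex by a path, and every continuous
  gauge-invariant `F : (E → G) → ℝ`: for every `ε > 0` there is an element `p` of the real span of the finite products of
  `U ↦ Re/Im tr ρ(hol_U ℓ)`, `ℓ` a loop based at `v₀`, with `|F U − p U| ≤ ε` for all `U` (density in the sup norm of the
  Wilson-loop algebra in the gauge-invariant continuous functions = density in `C(G^E/G^V)`); instance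
  `LevyDensity.dense_su2` for `G = SU(2) = Matrix.specialUnitaryGroup (Fin 2) ℂ`, `ρ = fundamentalRep (Fin 2)`, with NO
  hypothesis beyond connectedness (`dense_su2_of_connected`).

Design.  Paths are plain lists of signed edges with a validity predicate (no dependent walk type), so that a consumer maps
its own loops (e.g. `T3ContinuumYM3Torus`'s `ULoop3`) to lists; all algebra (`wordVal`, `tracePart`, `traceWordProduct(s)`,
`TraceWordsDense`) is module XX's, BY NAME.  The edge type must live in `Type` because the schema `TraceWordsDense`
quantifies over `ι : Type`.  Deliberately NOT here: the general-`G` invariant theory (Lévy Prop 3.4 for `U(n)`, `O(n)`,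
`Sp(n)`; the schema stays the hypothesis), the identification of the sup-norm closure with `C(G^E/G^V)` as a quotient space
(not needed by consumers, who work with gauge-invariant functions on `G^E`), disconnected graphs (apply the theorem
componentwise), and any measure / expectation statement (the `ε/3` transfer of convergence of expectations from a dense
class is `InfiniteVolumeSufficientXIX.hasUniqueInfiniteVolumeLimit_iff_tendsto_of_spans`-shaped and belongs to the user).

Sources: Lévy 2004 Thm 3.1, Props 3.4–3.6, Remark 2.4 [Levy2004]; Sengupta 1994 Thm 2 [Sengupta1994].  Cell record:
run/shared/lean/pub/ym3-torus/LIT-INDEX.md §4 L-3 (v2.1).  Namespace = directory (CONVENTIONS §2): every declaration is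
`Literature.MathematicalPhysics.QuantumFieldTheory.Balaban1983to89.LevyDensity.*` (2026-08-25 fix of the first landing, which
had skipped the `Balaban1983to89` component; consumers inside `namespace …Balaban1983to89` write `LevyDensity.dense_su2` unchanged).
-/

namespace Literature.MathematicalPhysics.QuantumFieldTheory.Balaban1983to89

open _root_.Topology
open Literature.MathematicalPhysics.QuantumLattice
open Literature.MathematicalPhysics.QuantumFieldTheory.Balaban1983to89.Missing (TraceWordsDense)

namespace LevyDensity

/-! ## PART A — SIGNED-EDGE PATHS ON AN ORIENTED MULTIGRAPH, HOLONOMIES, GAUGE TRANSFORMATIONS -/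

section Paths

variable {V E : Type*} (src tgt : E → V)

/-- The START vertex of a signed edge: `(e, true)` runs `src e → tgt e`, `(e, false)` runs `tgt e → src e` (Lévy 2004 §2:
edges with both orientations, `e⁻¹`). [cite: Levy2004, §2] -/
def startPt : E × Bool → V
  | (e, true) => src e
  | (e, false) => tgt e

/-- The END vertex of a signed edge. [cite: Levy2004, §2] -/
def endPt : E × Bool → V
  | (e, true) => tgt e
  | (e, false) => src e

/-- `IsPath src tgt x l y`: the list `l` of signed edges is a PATH from `x` to `y` (consecutive endpoints match; the
empty list is a path from `x` to `x`).  Lévy 2004 §2: paths as finite sequences of edges `e₁ … eₙ` with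
matching endpoints; loops = paths with equal endpoints. [cite: Levy2004, §2] -/
def IsPath : V → List (E × Bool) → V → Prop
  | x, [], y => x = y
  | x, a :: l, y => startPt src tgt a = x ∧ IsPath (endPt src tgt a) l y

/-- Unfolding `IsPath` on the empty list (the empty path at `x`). [cite: Levy2004, §2] -/
@[simp] theorem isPath_nil (x y : V) : IsPath src tgt x [] y ↔ x = y := Iff.rfl

/-- Unfolding `IsPath` on a cons: Lévy's condition `t(eᵢ) = s(eᵢ₊₁)`. [cite: Levy2004, §2] -/
@[simp] theorem isPath_cons (x y : V) (a : E × Bool) (l : List (E × Bool)) :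
    IsPath src tgt x (a :: l) y ↔ startPt src tgt a = x ∧ IsPath src tgt (endPt src tgt a) l y := Iff.rfl

/-- The reversed signed edge `e^{∓1}`. [folklore] -/
def flipLetter (a : E × Bool) : E × Bool := (a.1, !a.2)

/-- The start of the reversed edge is the end of the edge: `s(e⁻¹) = t(e)` (Lévy §2: «s(e,−) = t(e)»). [cite: Levy2004, §2] -/
@[simp] theorem startPt_flipLetter (a : E × Bool) : startPt src tgt (flipLetter a) = endPt src tgt a := by
  rcases a with ⟨e, _ | _⟩ <;> rfl

/-- The end of the reversed edge is the start of the edge: `t(e⁻¹) = s(e)`. [cite: Levy2004, §2] -/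
@[simp] theorem endPt_flipLetter (a : E × Bool) : endPt src tgt (flipLetter a) = startPt src tgt a := by
  rcases a with ⟨e, _ | _⟩ <;> rfl

/-- The INVERSE path `l⁻¹`: reverse the list and flip every edge. [cite: Levy2004, §2] -/
def invPath (l : List (E × Bool)) : List (E × Bool) := (l.map flipLetter).reverse

/-- `invPath [] = []`. [folklore] -/
@[simp] private theorem invPath_nil : invPath ([] : List (E × Bool)) = [] := rfl

/-- `invPath (a :: l) = invPath l ++ [a⁻¹]`. [folklore] -/
private theorem invPath_cons (a : E × Bool) (l : List (E × Bool)) : invPath (a :: l) = invPath l ++ [flipLetter a] := by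
  simp [invPath]

/-- Concatenation of paths is a path (Lévy, proof of Prop 3.6: «any product of the `lᵢ`'s and their inverses is still a
loop based at `v`»). [cite: Levy2004, Prop 3.6] -/
theorem isPath_append : ∀ {x y z : V} {l₁ l₂ : List (E × Bool)},
    IsPath src tgt x l₁ y → IsPath src tgt y l₂ z → IsPath src tgt x (l₁ ++ l₂) z
  | x, y, z, [], l₂, h₁, h₂ => by
    simp only [isPath_nil] at h₁
    subst h₁
    simpa using h₂
  | x, y, z, a :: l₁, l₂, h₁, h₂ => by
    simp only [List.cons_append, isPath_cons] at h₁ ⊢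
    exact ⟨h₁.1, isPath_append h₁.2 h₂⟩

/-- The inverse of a path from `x` to `y` is a path from `y` to `x` (Lévy, proof of Prop 3.6, inverses of loops).
[cite: Levy2004, Prop 3.6] -/
theorem isPath_invPath : ∀ {x y : V} {l : List (E × Bool)}, IsPath src tgt x l y → IsPath src tgt y (invPath l) x
  | x, y, [], h => by
    simp only [isPath_nil] at h
    subst h
    simp
  | x, y, a :: l, h => by
    simp only [isPath_cons] at h
    rw [invPath_cons]
    refine isPath_append src tgt (isPath_invPath h.2) ?_
    simp [h.1]

variable {G : Type*} [Group G]

/-- Holonomy is multiplicative under concatenation: `hol(l₁ · l₂) = hol(l₁) · hol(l₂)` (the holonomy of a list of signed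
edges is module XX's `wordVal l U = ∏ U_e^{±1}`, ordered product `U_{e₁}^{±1} ⋯ U_{eₙ}^{±1}`; Lévy §2 writes the
holonomy in the opposite order, `h_l(g) = g_{eₙ} ⋯ g_{e₁}` — an orientation convention only). [cite: Levy2004, §2] -/
theorem wordVal_append (l₁ l₂ : List (E × Bool)) (U : E → G) :
    wordVal (l₁ ++ l₂) U = wordVal l₁ U * wordVal l₂ U := by
  simp [wordVal, List.map_append, List.prod_append]

/-- The value of a reversed edge is the inverse value: `g_{(e,−)} = g_e⁻¹` (Lévy §2). [cite: Levy2004, §2] -/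
@[simp] theorem letterVal_flipLetter (U : E → G) (a : E × Bool) :
    letterVal U (flipLetter a) = (letterVal U a)⁻¹ := by
  rcases a with ⟨e, _ | _⟩ <;> simp [letterVal, flipLetter]

/-- `hol(l⁻¹) = hol(l)⁻¹`. [cite: Levy2004, §2] -/
theorem wordVal_invPath (l : List (E × Bool)) (U : E → G) : wordVal (invPath l) U = (wordVal l U)⁻¹ := by
  induction l with
  | nil => simp
  | cons a l ih =>
    rw [invPath_cons, wordVal_append, ih, wordVal_cons, wordVal_cons, wordVal_nil, mul_one, letterVal_flipLetter,
      mul_inv_rev]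

/-- The GAUGE TRANSFORMATION of a configuration `U : E → G` by `u : V → G`:
`(u • U)(e) = u(src e) · U(e) · u(tgt e)⁻¹` (Lévy 2004 §2: the action of `G^V` on `G^E`). [cite: Levy2004, §2] -/
def gaugeAct (u : V → G) (U : E → G) : E → G := fun e => u (src e) * U e * (u (tgt e))⁻¹

/-- A signed edge transforms as `u(start) · U_e^{±1} · u(end)⁻¹`. [folklore] -/
private theorem letterVal_gaugeAct (u : V → G) (U : E → G) (a : E × Bool) :
    letterVal (gaugeAct src tgt u U) a = u (startPt src tgt a) * letterVal U a * (u (endPt src tgt a))⁻¹ := by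
  rcases a with ⟨e, _ | _⟩
  · simp [letterVal, gaugeAct, startPt, endPt, mul_assoc]
  · simp [letterVal, gaugeAct, startPt, endPt, mul_assoc]

/-- **Covariance of holonomy.**  The holonomy of a genuine path `x ⤳ y` transforms as
`hol_{u•U}(l) = u(x) · hol_U(l) · u(y)⁻¹`. [cite: Levy2004, §2] -/
theorem wordVal_gaugeAct : ∀ {x y : V} {l : List (E × Bool)}, IsPath src tgt x l y → ∀ (u : V → G) (U : E → G),
    wordVal l (gaugeAct src tgt u U) = u x * wordVal l U * (u y)⁻¹
  | x, y, [], h, u, U => by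
    simp only [isPath_nil] at h
    subst h
    simp
  | x, y, a :: l, h, u, U => by
    simp only [isPath_cons] at h
    obtain ⟨h₁, h₂⟩ := h
    subst h₁
    rw [wordVal_cons, wordVal_cons, letterVal_gaugeAct, wordVal_gaugeAct h₂ u U]
    simp [mul_assoc]

/-- `F` is GAUGE INVARIANT: `F (u • U) = F U` for every gauge transformation `u : V → G` (a function on `G^E/G^V`).
[cite: Levy2004, §2] -/
def IsGaugeInvariant {α : Type*} (F : (E → G) → α) : Prop := ∀ (u : V → G) (U : E → G), F (gaugeAct src tgt u U) = F U

/-- A constant gauge transformation is simultaneous (diagonal) conjugation of all edge variables (Lévy §2, Example 2.2: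
«`G^V = G` acts by diagonal conjugation»). [cite: Levy2004, §2] -/
theorem gaugeAct_const (g : G) (U : E → G) : gaugeAct src tgt (fun _ => g) U = fun e => g * U e * g⁻¹ := rfl

/-! ### Lassos: Lévy's reduction to loops based at one vertex -/

variable (π : V → List (E × Bool))

/-- THE LASSO of the edge `e` relative to the chosen paths `π x` (meant: from a base vertex `v₀` to `x`):
`π(src e) · e · π(tgt e)⁻¹` (Lévy 2004, proof of Prop 3.5: «for every vertex `w`, choose a path `p` in `Γ` joining `w`
to `v`»; Driver's "lassos"). [cite: Levy2004, Prop 3.5] -/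
def lassoWord (e : E) : List (E × Bool) := π (src e) ++ (e, true) :: invPath (π (tgt e))

/-- The configuration of LASSO HOLONOMIES `e ↦ hol_U(lasso e)`. [cite: Levy2004, Prop 3.5] -/
def lassoConfig (U : E → G) : E → G := fun e => wordVal (lassoWord src tgt π e) U

/-- The AXIAL gauge function of `U` along the chosen paths: `x ↦ hol_U(π x)`. [cite: Levy2004, Prop 3.5] -/
def axialGauge (U : E → G) : V → G := fun x => wordVal (π x) U

/-- `hol_U(lasso e) = hol_U(π(src e)) · U e · hol_U(π(tgt e))⁻¹`. [cite: Levy2004, Prop 3.5] -/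
theorem lassoConfig_apply (U : E → G) (e : E) :
    lassoConfig src tgt π U e = axialGauge π U (src e) * U e * (axialGauge π U (tgt e))⁻¹ := by
  simp [lassoConfig, lassoWord, axialGauge, wordVal_append, wordVal_invPath, letterVal, mul_assoc]

/-- **KEY IDENTITY.**  Gauge-transforming `U` by its own axial gauge function produces the configuration of lasso
holonomies: `U^{axialGauge U} = lassoConfig U`. [cite: Levy2004, Prop 3.5] -/
theorem gaugeAct_axialGauge (U : E → G) : gaugeAct src tgt (axialGauge π U) U = lassoConfig src tgt π U :=
  funext fun e => (lassoConfig_apply src tgt π U e).symm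

/-- **THE LASSO REPRESENTATION.**  A gauge-invariant function of the configuration is a function of the lasso
holonomies: `F U = F (lassoConfig U)` — for ANY choice of the lists `π x` (their being paths matters only for the
interpretation of the lassos as loops, below). [cite: Levy2004, Prop 3.5] -/
theorem eq_lassoConfig {α : Type*} {F : (E → G) → α} (hF : IsGaugeInvariant src tgt F) (U : E → G) :
    F U = F (lassoConfig src tgt π U) := by
  rw [← gaugeAct_axialGauge, hF]

/-- If every `π x` is a path from `v₀` to `x`, every lasso is a LOOP based at `v₀`. [cite: Levy2004, Prop 3.5] -/
theorem isPath_lassoWord {v₀ : V} (hπ : ∀ x, IsPath src tgt v₀ (π x) x) (e : E) :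
    IsPath src tgt v₀ (lassoWord src tgt π e) v₀ := by
  refine isPath_append src tgt (hπ (src e)) ?_
  exact ⟨rfl, isPath_invPath src tgt (hπ (tgt e))⟩

/-- The lasso spelled by a signed edge: `lasso e` or its inverse. [folklore] -/
def letterLassoWord : E × Bool → List (E × Bool)
  | (e, true) => lassoWord src tgt π e
  | (e, false) => invPath (lassoWord src tgt π e)

/-- The based loop spelled by a WORD in the lassos (concatenation; Lévy 2004, proof of Prop 3.6: «any product of the
`lᵢ`'s and their inverses is still a loop based at `v`»). [cite: Levy2004, Prop 3.6] -/
def wordLassoWord : List (E × Bool) → List (E × Bool)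
  | [] => []
  | a :: w => letterLassoWord src tgt π a ++ wordLassoWord w

/-- The holonomy of the lasso of a letter is the letter evaluated at the lasso holonomies. [folklore] -/
private theorem wordVal_letterLassoWord (U : E → G) (a : E × Bool) :
    wordVal (letterLassoWord src tgt π a) U = letterVal (lassoConfig src tgt π U) a := by
  rcases a with ⟨e, _ | _⟩
  · simp [letterLassoWord, letterVal, lassoConfig, wordVal_invPath]
  · simp [letterLassoWord, letterVal, lassoConfig]

/-- **Words in lassos are loops**: `hol_U(wordLassoWord w) = w(lassoConfig U)`. [cite: Levy2004, Prop 3.6] -/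
theorem wordVal_wordLassoWord (U : E → G) :
    ∀ w : List (E × Bool), wordVal (wordLassoWord src tgt π w) U = wordVal w (lassoConfig src tgt π U)
  | [] => by simp [wordLassoWord]
  | a :: w => by
    rw [wordLassoWord, wordVal_append, wordVal_letterLassoWord, wordVal_wordLassoWord U w, wordVal_cons]

/-- The lasso of a letter is a based loop. [folklore] -/
private theorem isPath_letterLassoWord {v₀ : V} (hπ : ∀ x, IsPath src tgt v₀ (π x) x) (a : E × Bool) :
    IsPath src tgt v₀ (letterLassoWord src tgt π a) v₀ := by
  rcases a with ⟨e, _ | _⟩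
  · exact isPath_invPath src tgt (isPath_lassoWord src tgt π hπ e)
  · exact isPath_lassoWord src tgt π hπ e

/-- A word in the lassos is a based loop. [cite: Levy2004, Prop 3.6] -/
theorem isPath_wordLassoWord {v₀ : V} (hπ : ∀ x, IsPath src tgt v₀ (π x) x) :
    ∀ w : List (E × Bool), IsPath src tgt v₀ (wordLassoWord src tgt π w) v₀
  | [] => rfl
  | a :: w => isPath_append src tgt (isPath_letterLassoWord src tgt π hπ a) (isPath_wordLassoWord hπ w)

end Paths

/-! ## PART B — THE WILSON-LOOP ALGEBRA AT A BASE VERTEX -/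

section LoopAlgebra

variable {V E : Type*} (src tgt : E → V) {G : Type*} [Group G] {N : ℕ} (ρ : G →* Matrix (Fin N) (Fin N) ℂ) (v₀ : V)

/-- The LOOPS BASED AT `v₀`: signed-edge lists that are paths from `v₀` to `v₀`. [cite: Levy2004, §2] -/
def Loop : Type _ := {l : List (E × Bool) // IsPath src tgt v₀ l v₀}

/-- A finite PRODUCT OF WILSON-LOOP GENERATORS `U ↦ ∏ₖ Re/Im tr ρ(hol_U ℓₖ)`, `ℓₖ` loops based at `v₀` (`1` for the
empty list) — the elements whose real span is the real algebra generated by the Wilson loops `W_ℓ = tr ρ ∘ hol_ℓ` in the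
representation `ρ` (Lévy 2004 §2: `W_{α,l} = χ_α ∘ h_l`; here `χ = tr ρ`, split into real and imaginary parts).
[cite: Levy2004, Thm 3.1] -/
def loopTraceProduct (l : List (Loop src tgt v₀ × Bool)) (U : E → G) : ℝ :=
  (l.map fun p => tracePart ρ p.2 (wordVal p.1.1 U)).prod

/-- The GENERATING CLASS of the Wilson-loop algebra at `v₀`: all finite products of real and imaginary parts of traces of
holonomies of based loops. [cite: Levy2004, Thm 3.1] -/
def loopTraceProducts : Set ((E → G) → ℝ) := Set.range (loopTraceProduct src tgt ρ v₀)

/-- `loopTraceProduct ρ v₀ [] = 1`. [folklore] -/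
@[simp] private theorem loopTraceProduct_nil : loopTraceProduct src tgt ρ v₀ [] = fun _ => 1 := by
  funext U; simp [loopTraceProduct]

/-- `loopTraceProduct ρ v₀ (p :: l) U = Re/Im tr ρ(hol_U p) · loopTraceProduct ρ v₀ l U`. [folklore] -/
@[simp] private theorem loopTraceProduct_cons (p : Loop src tgt v₀ × Bool) (l : List (Loop src tgt v₀ × Bool)) :
    loopTraceProduct src tgt ρ v₀ (p :: l) = fun U => tracePart ρ p.2 (wordVal p.1.1 U) * loopTraceProduct src tgt ρ v₀ l U := by
  funext U; simp [loopTraceProduct]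

/-- **Wilson-loop products are gauge invariant** (holonomy covariance + cyclicity of the trace). [cite: Levy2004, §2] -/
theorem isGaugeInvariant_loopTraceProduct :
    ∀ l : List (Loop src tgt v₀ × Bool), IsGaugeInvariant src tgt (loopTraceProduct src tgt ρ v₀ l)
  | [] => fun u U => by simp
  | p :: l => fun u U => by
    have ih := isGaugeInvariant_loopTraceProduct l u U
    simp only [loopTraceProduct_cons] at ih ⊢
    rw [ih, wordVal_gaugeAct src tgt p.1.2 u U, tracePart_conj]

/-- The lists of based loops attached to a list of words in the edges (each word spelled in the lassos). [folklore] -/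
def loopsOfWords (π : V → List (E × Bool)) (hπ : ∀ x, IsPath src tgt v₀ (π x) x)
    (l : List (List (E × Bool) × Bool)) : List (Loop src tgt v₀ × Bool) :=
  l.map fun p => (⟨wordLassoWord src tgt π p.1, isPath_wordLassoWord src tgt π hπ p.1⟩, p.2)

/-- A product of trace words in the edge variables, evaluated at the lasso holonomies, IS a Wilson-loop product.
[cite: Levy2004, Prop 3.6] -/
theorem traceWordProduct_lassoConfig (π : V → List (E × Bool)) (hπ : ∀ x, IsPath src tgt v₀ (π x) x) :
    ∀ (l : List (List (E × Bool) × Bool)) (U : E → G),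
      traceWordProduct ρ l (lassoConfig src tgt π U) = loopTraceProduct src tgt ρ v₀ (loopsOfWords src tgt v₀ π hπ l) U
  | [], U => by simp [loopsOfWords]
  | p :: l, U => by
    have ih := traceWordProduct_lassoConfig π hπ l U
    simp only [loopsOfWords, List.map_cons, traceWordProduct_cons, loopTraceProduct_cons] at ih ⊢
    rw [wordVal_wordLassoWord, ih]

/-- Hence precomposition with the lasso holonomies maps the span of the trace-word products into the span of the
Wilson-loop products (precomposition is linear). [cite: Levy2004, Prop 3.6] -/
theorem comp_lassoConfig_mem_span (π : V → List (E × Bool)) (hπ : ∀ x, IsPath src tgt v₀ (π x) x)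
    {p : (E → G) → ℝ} (hp : p ∈ Submodule.span ℝ (traceWordProducts ρ E)) :
    (fun U : E → G => p (lassoConfig src tgt π U)) ∈ Submodule.span ℝ (loopTraceProducts src tgt ρ v₀) := by
  let Λ : ((E → G) → ℝ) →ₗ[ℝ] ((E → G) → ℝ) := LinearMap.funLeft ℝ ℝ (lassoConfig src tgt π)
  have h := Submodule.apply_mem_span_image_of_mem_span Λ hp
  refine Submodule.span_mono ?_ h
  rintro _ ⟨q, ⟨l, rfl⟩, rfl⟩
  exact ⟨loopsOfWords src tgt v₀ π hπ l, by
    funext U; exact (traceWordProduct_lassoConfig src tgt ρ v₀ π hπ l U).symm⟩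

variable [TopologicalSpace G]

/-- Wilson-loop products are continuous for a topological group and a continuous representation (Lévy §2: «Wilson loops
are continuous functions on `C^G_Γ` or, equivalently, continuous functions on `G^E` invariant under the action of `G^V`»).
[cite: Levy2004, §2] -/
theorem continuous_loopTraceProduct [IsTopologicalGroup G] (hρ : Continuous ρ) :
    ∀ l : List (Loop src tgt v₀ × Bool), Continuous (loopTraceProduct src tgt ρ v₀ l)
  | [] => by simp only [loopTraceProduct_nil]; exact continuous_const
  | p :: l => by
    simp only [loopTraceProduct_cons]
    exact ((continuous_tracePart ρ hρ p.2).comp (continuous_wordVal p.1.1)).mul (continuous_loopTraceProduct hρ l)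

end LoopAlgebra

/-! ## PART C — THE DENSITY THEOREM -/

section Density

variable {V : Type*} {E : Type} [Fintype E] (src tgt : E → V) {G : Type*} [Group G] [TopologicalSpace G] {N : ℕ}
  (ρ : G →* Matrix (Fin N) (Fin N) ℂ)

/-- **LÉVY'S DENSITY THEOREM ON A FINITE CONNECTED GRAPH, natural-representation form, modulo the invariant theory.**
If the word traces of `ρ` are dense in the sense of module XX's schema `TraceWordsDense ρ` (Lévy 2004 Prop 3.4 +
Stone–Weierstrass; PROVED in the tree for `SU(2)`), then for every finite oriented multigraph `(src tgt : E → V)`, every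
base vertex `v₀` joined to every vertex `x` by a path `π x`, and every continuous gauge-invariant `F : (E → G) → ℝ`:
for every `ε > 0` some element `p` of the real span of the Wilson-loop products based at `v₀` satisfies `|F U − p U| ≤ ε`
for all configurations `U` — the algebra generated by the Wilson loops is dense, in the sup norm, in the gauge-invariant
continuous functions, i.e. in `C(G^E/G^V)` (Lévy 2004 Thm 3.1, proof of Prop 3.6: lasso representation, words in lassos
are loops, «the result follows by the Stone-Weierstrass theorem»). [cite: Levy2004, Thm 3.1] -/
theorem dense_of_traceWordsDense (hT : TraceWordsDense ρ) {v₀ : V} (π : V → List (E × Bool))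
    (hπ : ∀ x, IsPath src tgt v₀ (π x) x) {F : (E → G) → ℝ} (hFc : Continuous F) (hFi : IsGaugeInvariant src tgt F)
    {ε : ℝ} (hε : 0 < ε) :
    ∃ p ∈ Submodule.span ℝ (loopTraceProducts src tgt ρ v₀), ∀ U, |F U - p U| ≤ ε := by
  obtain ⟨p₀, hp₀, hFp₀⟩ := hT E F hFc (fun g U => hFi (fun _ => g) U) ε hε
  refine ⟨fun U => p₀ (lassoConfig src tgt π U), comp_lassoConfig_mem_span src tgt ρ v₀ π hπ hp₀, fun U => ?_⟩
  rw [eq_lassoConfig src tgt π hFi U]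
  exact hFp₀ _

/-- The same with connectedness as an existential hypothesis (the paths are chosen). [cite: Levy2004, Thm 3.1] -/
theorem dense_of_traceWordsDense_of_connected (hT : TraceWordsDense ρ) {v₀ : V}
    (hconn : ∀ x, ∃ l, IsPath src tgt v₀ l x) {F : (E → G) → ℝ} (hFc : Continuous F)
    (hFi : IsGaugeInvariant src tgt F) {ε : ℝ} (hε : 0 < ε) :
    ∃ p ∈ Submodule.span ℝ (loopTraceProducts src tgt ρ v₀), ∀ U, |F U - p U| ≤ ε :=
  dense_of_traceWordsDense src tgt ρ hT (fun x => (hconn x).choose) (fun x => (hconn x).choose_spec) hFc hFi hε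

end Density

/-! ## PART D — THE INSTANCE `SU(2)` (no hypothesis beyond connectedness) -/

section SU2

variable {V : Type*} {E : Type} [Fintype E] (src tgt : E → V)

/-- **LÉVY'S DENSITY THEOREM FOR `SU(2)` ON A FINITE CONNECTED GRAPH.**  For `G = SU(2)` (`Matrix.specialUnitaryGroup
(Fin 2) ℂ`) with its defining representation, every continuous gauge-invariant function of a configuration on a finite
oriented multigraph with a base vertex `v₀` joined to every vertex by a path `π x` is, for every `ε > 0`, uniformly within
`ε` of a real linear combination of finite products of `U ↦ Re/Im tr hol_U(ℓ)`, `ℓ` loops based at `v₀` (Lévy 2004 Thm 3.1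
for `G = SU(2)`; the invariant theory is the tree's `traceWordsDense_su2` = Lévy Prop 3.4 / Sengupta 1994 Thm 2 for
`SU(2)`).  For `SU(2)` the traces are real, so the `Im` generators vanish and products of `Re tr` suffice.
[cite: Levy2004, Thm 3.1] -/
theorem dense_su2 {v₀ : V} (π : V → List (E × Bool)) (hπ : ∀ x, IsPath src tgt v₀ (π x) x)
    {F : (E → Matrix.specialUnitaryGroup (Fin 2) ℂ) → ℝ} (hFc : Continuous F) (hFi : IsGaugeInvariant src tgt F)
    {ε : ℝ} (hε : 0 < ε) :
    ∃ p ∈ Submodule.span ℝ (loopTraceProducts src tgt (fundamentalRep (Fin 2)) v₀), ∀ U, |F U - p U| ≤ ε :=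
  dense_of_traceWordsDense src tgt (fundamentalRep (Fin 2)) traceWordsDense_su2 π hπ hFc hFi hε

/-- The `SU(2)` theorem with connectedness as an existential hypothesis. [cite: Levy2004, Thm 3.1] -/
theorem dense_su2_of_connected {v₀ : V} (hconn : ∀ x, ∃ l, IsPath src tgt v₀ l x)
    {F : (E → Matrix.specialUnitaryGroup (Fin 2) ℂ) → ℝ} (hFc : Continuous F) (hFi : IsGaugeInvariant src tgt F)
    {ε : ℝ} (hε : 0 < ε) :
    ∃ p ∈ Submodule.span ℝ (loopTraceProducts src tgt (fundamentalRep (Fin 2)) v₀), ∀ U, |F U - p U| ≤ ε :=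
  dense_of_traceWordsDense_of_connected src tgt (fundamentalRep (Fin 2)) traceWordsDense_su2 hconn hFc hFi hε

end SU2

end LevyDensity

end Literature.MathematicalPhysics.QuantumFieldTheory.Balaban1983to89
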